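import Summits.NavierStokesRegularity.NavierStokesRegularity.Theses.AngularGalerkinLadder
import Literature.Analysis.FluidPDE.TypeIAncientMildClassical
import Literature.Analysis.FluidPDE.ClassicalSolutionGlue
import Literature.Analysis.FluidPDE.SpaceTimeCalculus
import Literature.Analysis.FluidPDE.LocalTypeIBlowup.SingularVertexZoom

/-!
# Route `AngularGalerkinLadder` · K3a `LocalCompactness` (item 19856), line `engine`, stub B —
# the TREE-BACKED part: a continuous, weakly divergence-free, Type-I, unforced Oseen-mild field on
# the open past is a Type-I ancient mild field, hence a classical solution there for SOME pressure

Cell `ns-blowup`, seat `ns-blowup-lean` (g11, K3a holder; `--supports stmt-NavierStokesRegularity-19856`,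
helper). LABEL: KERNEL support (sorry-free). WHAT THIS IS NOT: not Navier–Stokes evidence — regularity
bookkeeping for a GIVEN Oseen-mild field; no window sequence or limit is constructed; the registered stub
`stub_classical_of_typeI_oseenMild` is NOT closed here: its last conjunct, a pressure BOUNDED on every
past slab `(−∞, t]`, has no tree road (physical gauge + Calderón–Zygmund + KNSS derivative bounds;
refuter g14 KJ-22: `HasTypeIDecay` load-bearing) and is the only part of stub B left open.

## Content

* `isTypeIAncientMild_of_typeI_oseenMild` — the engine's limit class (continuous on `(−∞,0) × ℝ³`,
  weakly divergence-free slices, `HasTypeIDecay C₀`, unforced Oseen identity) is the tree's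
  `IsTypeIAncientMild C₀` (KNSS Prop 4.1 smoothing inside
  `LocalTypeIBlowup.isTypeIAncientMild_of_continuous_oseenMild_rate`);
* `exists_isClassicalNSSolutionOn_Iio_of_typeI_oseenMild` — hence a classical solution of the
  unforced system (`ν = 1`) on `Iio 0` for ONE smooth pressure (window pressures of
  `IsTypeIAncientMild.exists_isClassicalNSSolutionOn_Ioo`, normalised at the spatial origin and glued —
  private copy of the argument of `Theorems/AdaptedFrequencyTangentFlowTransferAncientPressure`, kept
  here to stay outside that route's cone), and an ancient mild solution in duality form.

References: [cite: KochNadirashviliSereginSverak2009, §4 Prop. 4.1 and p. 8 (arXiv:0709.3599)];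
[cite: FabesJonesRiviere1972, Thm. 2.1].
-/

noncomputable section

set_option linter.dupNamespace false

namespace Summit.NavierStokesRegularity.NavierStokesRegularity.Theorems

open Set Filter MeasureTheory Topology Function Metric
open Literature.Analysis Literature.Analysis.FluidPDE

/-- **One pressure on the whole past for a Type-I ancient mild field** (window pressures normalised at
the origin and glued). Private copy of `Theorems.exists_isClassicalNSSolutionOn_Iio_of_isTypeIAncientMild`
(route AdaptedFrequency's file), to avoid importing another route's cone.
[cite: KochNadirashviliSereginSverak2009, §4 p. 8 (arXiv:0709.3599)] -/
private theorem exists_isClassicalNSSolutionOn_Iio_of_isTypeIAncientMild'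
    {E : Type*} [NormedAddCommGroup E] [InnerProductSpace ℝ E] [FiniteDimensional ℝ E]
    [MeasurableSpace E] [BorelSpace E] {C : ℝ} {u : ℝ → E → E} (hu : IsTypeIAncientMild C u) :
    ∃ q : ℝ → E → ℝ, IsClassicalNSSolutionOn (Iio 0) 1 0 u q := by
  have hwin : ∀ n : ℕ, ∃ p : ℝ → E → ℝ, IsClassicalNSSolutionOn (Ioo (-((n : ℝ) + 1)) 0) 1 0 u p :=
    fun n => hu.exists_isClassicalNSSolutionOn_Ioo (by
      have : (0 : ℝ) ≤ n := Nat.cast_nonneg n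
      linarith)
  choose p hp using hwin
  set idx : ℝ → ℕ := fun t => Nat.ceil (-t) with hidx
  have hmem : ∀ t < 0, t ∈ Ioo (-((idx t : ℝ) + 1)) 0 := fun t ht => by
    refine ⟨?_, ht⟩
    have h1 : -t ≤ (Nat.ceil (-t) : ℝ) := Nat.le_ceil (-t)
    simp only [hidx]
    linarith
  set q : ℝ → E → ℝ := fun t x => p (idx t) t x - p (idx t) t 0 with hq
  have hloc : ∀ n : ℕ, ∀ t ∈ Ioo (-((n : ℝ) + 1)) 0, ∀ x, q t x = p n t x - p n t 0 := by
    intro n t ht x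
    have ht0 : t < 0 := ht.2
    have h1 : Ioo (-((idx t : ℝ) + 1)) 0 ∈ 𝓝 t := isOpen_Ioo.mem_nhds (hmem t ht0)
    have h2 : Ioo (-((n : ℝ) + 1)) 0 ∈ 𝓝 t := isOpen_Ioo.mem_nhds ht
    exact (hp (idx t)).pressure_sub_apply_zero_eq_of_eventuallyEq (hp n) h1 h2
      (Eventually.of_forall fun _ => rfl) x
  refine ⟨q, ?_, ?_, ?_, ?_⟩
  · exact hu.contDiffOn
  · refine contDiffOn_of_locally_contDiffOn ?_
    rintro ⟨t, x⟩ ⟨ht, -⟩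
    have ht0 : t < 0 := ht
    set n := idx t
    refine ⟨Ioo (-((n : ℝ) + 1)) 0 ×ˢ univ, isOpen_Ioo.prod isOpen_univ,
      ⟨hmem t ht0, mem_univ _⟩, ?_⟩
    have hsm : IsSmoothSpaceTimeOn (Ioo (-((n : ℝ) + 1)) 0) (fun s y => p n s y - p n s 0) :=
      (hp n).smooth_pressure.sub_apply_zero
    have hsub : Iio (0 : ℝ) ×ˢ (univ : Set E) ∩ Ioo (-((n : ℝ) + 1)) 0 ×ˢ univ =
        Ioo (-((n : ℝ) + 1)) 0 ×ˢ univ := by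
      ext ⟨s, y⟩
      simp only [mem_inter_iff, mem_prod, mem_Iio, mem_Ioo, mem_univ, and_true]
      constructor
      · rintro ⟨-, h⟩; exact h
      · rintro h; exact ⟨h.2, h⟩
    rw [hsub]
    refine hsm.congr ?_
    rintro ⟨s, y⟩ ⟨hs, -⟩
    exact hloc n s hs y
  · intro t ht x
    have ht0 : t < 0 := ht
    set n := idx t
    have htn : t ∈ Ioo (-((n : ℝ) + 1)) 0 := hmem t ht0
    have hm := (hp n).momentum t htn x
    have hd : timeDerivWithin (Iio 0) u t x = timeDerivWithin (Ioo (-((n : ℝ) + 1)) 0) u t x := by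
      rw [timeDerivWithin_eq_deriv isOpen_Iio ht0 u x, timeDerivWithin_eq_deriv isOpen_Ioo htn u x]
    have hg : gradient (q t) x = gradient (p n t) x := by
      have e : q t = fun y => p n t y - p n t 0 := funext fun y => hloc n t htn y
      rw [e, gradient_sub_const]
    rw [hd, hg]
    exact hm
  · intro t ht
    exact hu.isDivFree ht

/-- **The engine's limit class is the tree's Type-I ancient mild class**: a field continuous on
`(−∞,0) × ℝ³` with weakly divergence-free slices, the Type-I space–time bound `C₀` and the UNFORCED
Oseen identity `W t = e^{(t−s)Δ}W s − B¹_s(W,W)(t)` for all `s < t < 0` is `IsTypeIAncientMild C₀`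
(KNSS Prop 4.1 smoothing inside the tree lemma
`LocalTypeIBlowup.isTypeIAncientMild_of_continuous_oseenMild_rate`).
[cite: KochNadirashviliSereginSverak2009, §4 Prop. 4.1 (arXiv:0709.3599)] -/
theorem isTypeIAncientMild_of_typeI_oseenMild {C₀ : ℝ}
    {W : ℝ → EuclideanSpace ℝ (Fin 3) → EuclideanSpace ℝ (Fin 3)}
    (hc : ContinuousOn (uncurry W) (Iio 0 ×ˢ univ)) (hdiv : ∀ t < 0, IsWeaklyDivFree (W t))
    (hTI : HasTypeIDecay C₀ W)
    (hmild : ∀ s t : ℝ, s < t → t < 0 → ∀ x,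
      W t x = UnboundedOperators.heatExtension (W s) (t - s) x - oseenDuhamel 1 s W W t x) :
    IsTypeIAncientMild C₀ W := by
  have hC₀ : 0 ≤ C₀ := by
    have h1 := (norm_nonneg _).trans (hTI (-1) (by norm_num) 0)
    simpa using h1
  exact LocalTypeIBlowup.isTypeIAncientMild_of_continuous_oseenMild_rate hc hdiv hmild
    (hTI.hasTypeITimeDecay hC₀)

/-- **Stub B of the `engine` line, tree-backed part**: a continuous, weakly divergence-free, Type-I,
unforced Oseen-mild field on the open past is a classical solution of the unforced Navier–Stokes
system (`ν = 1`) on `Iio 0` for ONE smooth pressure, and an ancient mild solution in duality form.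
(The registered stub additionally asks for a pressure bounded on every past slab — not proved here.)
[cite: KochNadirashviliSereginSverak2009, §4 (arXiv:0709.3599 p. 8)] -/
theorem exists_isClassicalNSSolutionOn_Iio_of_typeI_oseenMild {C₀ : ℝ}
    {W : ℝ → EuclideanSpace ℝ (Fin 3) → EuclideanSpace ℝ (Fin 3)}
    (hc : ContinuousOn (uncurry W) (Iio 0 ×ˢ univ)) (hdiv : ∀ t < 0, IsWeaklyDivFree (W t))
    (hTI : HasTypeIDecay C₀ W)
    (hmild : ∀ s t : ℝ, s < t → t < 0 → ∀ x,
      W t x = UnboundedOperators.heatExtension (W s) (t - s) x - oseenDuhamel 1 s W W t x) :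
    (∃ q : ℝ → EuclideanSpace ℝ (Fin 3) → ℝ, IsClassicalNSSolutionOn (Iio 0) 1 0 W q) ∧
      IsAncientMildSolution 1 W := by
  have hTAM := isTypeIAncientMild_of_typeI_oseenMild hc hdiv hTI hmild
  exact ⟨exists_isClassicalNSSolutionOn_Iio_of_isTypeIAncientMild' hTAM, hTAM.isAncientMildSolution⟩

end Summit.NavierStokesRegularity.NavierStokesRegularity.Theorems

end
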